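import Literature.Analysis.FluidPDE.LocalTypeIBlowup.SingularVertexZoom
import Summits.NavierStokesRegularity.NavierStokesRegularity.Theorems.TerminalTraceExtinctApexTopTrace
import HarnessLib

/-!
# Crux `TerminalTrace.TypeITraceScarL3` (stmt-NavierStokesRegularity-18385), STUB 2 support file 5a:
# auxiliary facts for the zoom at an `L³` apex — energies from `𝐈`, the `ε`–`δ` choice for the
# modulus, and the TOP VALUES of the pairings of parabolic zooms (weak continuity transported,
# scaling-out of the `L³` top slice)

Prover seat nsreg-p4 (gen 15); `--supports stmt-NavierStokesRegularity-18385`.  Theorems only.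

* `ae_lintegral_ball_sq_le_of_typeIBound_le` — `A(Q(0,a)) ≤ 𝐈 ≤ I` gives `∫_{B_a} |v(t)|² ≤ a I`
  for a.e. `t`;
* `exists_delta_modulus_le` — `K σ + K' σ^{1/3} ≤ ε` for `0 < σ < δ(ε)`;
* `tendsto_setIntegral_inner_zoom_nhdsLT` — weak continuity at the top time `t₀` of `u`
  (pairings with `C_c^∞` fields) transports to the parabolic zooms `λ u(t₀ + λ² s, x₀ + λ y)` at
  `s = 0` (change of variables `integral_inner_zoom_eq`);
* `tendsto_setIntegral_inner_zoom_zero` — the top values `∫_{B_a} ⟪λ_j u(t₀, x₀ + λ_j ·), φ⟫`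
  tend to `0` as `λ_j ↓ 0` when `u(t₀) ∈ L³(B(x₀, ρ))` (Hölder on the ball and the scaling-out
  `‖λV(x₀+λ·)‖_{L³(B(0,a))} = ‖V‖_{L³(B(x₀,λa))} → 0`, Seregin 2014 §6.6 p. 127 — the content of
  the typer seat's `Literature/Analysis/FluidPDE/L3LocalTraceScalingOut.lean`
  (`tendsto_eLpNorm_three_zoomTrace_seq_zero`), re-derived inside the proof because that module's
  build was unavailable on the farm at landing time);
* `memLp_three_top_slice`, `aestronglyMeasurable_top_slice` — the zoomed top slice
  `α f(x₀ + R·)` is in `L³(B(0, ρ))` when `f ∈ L³(B(x₀, ρ₃))`, `Rρ ≤ ρ₃`, and is a.e.-strongly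
  measurable when `f` is.

WHAT THIS IS NOT: not a regularity or blow-up claim; the crux and its open stubs are untouched.
-/

noncomputable section

open MeasureTheory Set Function Filter Topology TopologicalSpace Metric
open scoped NNReal ENNReal InnerProductSpace RealInnerProductSpace
open Literature.Analysis Literature.Analysis.FluidPDE Literature.Analysis.FluidPDE.LocalTypeIBlowup
open Summit.NavierStokesRegularity.NavierStokesRegularity.Theorems.TerminalTraceExtinctApexTopTrace

namespace Summit.NavierStokesRegularity.NavierStokesRegularity.Theorems.TerminalTraceExtinctApexZoom

/-! ## Two auxiliary facts -/

/-- From `A(Q(0, a)) ≤ 𝐈 ≤ I`: the spatial energies on `B(0, a)` are `≤ a I` for a.e. time. -/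
theorem ae_lintegral_ball_sq_le_of_typeIBound_le {a : ℝ} (ha : 0 < a)
    {v : ℝ → EuclideanSpace ℝ (Fin 3) → EuclideanSpace ℝ (Fin 3)}
    {q : ℝ → EuclideanSpace ℝ (Fin 3) → ℝ}
    {G : ℝ → EuclideanSpace ℝ (Fin 3) → EuclideanSpace ℝ (Fin 3) →L[ℝ] EuclideanSpace ℝ (Fin 3)}
    {I : ℝ≥0∞}
    (hI : typeIBound (parabolicCylinder a (0 : ℝ × EuclideanSpace ℝ (Fin 3))) v q G ≤ I) :
    ∀ᵐ t ∂(volume.restrict (Ioo ((0 : ℝ × EuclideanSpace ℝ (Fin 3)).1 - a ^ 2)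
      (0 : ℝ × EuclideanSpace ℝ (Fin 3)).1)),
      ∫⁻ x in ball (0 : ℝ × EuclideanSpace ℝ (Fin 3)).2 a, ‖v t x‖ₑ ^ 2 ≤ ENNReal.ofReal a * I := by
  have hA : cknAEss a (0 : ℝ × EuclideanSpace ℝ (Fin 3)) v ≤ I :=
    (cknAEss_le_abScaledSum (p := q) (G := G)).trans ((abScaledSum_le_typeIBound ha Subset.rfl).trans hI)
  have ha0 : ENNReal.ofReal a ≠ 0 := (ENNReal.ofReal_pos.2 ha).ne'
  have hat : ENNReal.ofReal a ≠ ⊤ := ENNReal.ofReal_ne_top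
  unfold cknAEss at hA
  filter_upwards [ENNReal.ae_le_essSup fun t : ℝ => (ENNReal.ofReal a)⁻¹ *
    ∫⁻ x in ball (0 : ℝ × EuclideanSpace ℝ (Fin 3)).2 a, ‖v t x‖ₑ ^ 2] with t ht
  have h := ht.trans hA
  calc ∫⁻ x in ball (0 : ℝ × EuclideanSpace ℝ (Fin 3)).2 a, ‖v t x‖ₑ ^ 2
      = ENNReal.ofReal a * ((ENNReal.ofReal a)⁻¹ *
          ∫⁻ x in ball (0 : ℝ × EuclideanSpace ℝ (Fin 3)).2 a, ‖v t x‖ₑ ^ 2) := by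
        rw [← mul_assoc, ENNReal.mul_inv_cancel ha0 hat, one_mul]
    _ ≤ ENNReal.ofReal a * I := mul_le_mul' le_rfl h

/-- A modulus `K σ + K' σ^{1/3}` is `≤ ε` for `0 < σ ≤ δ(ε)`. -/
theorem exists_delta_modulus_le {K K' ε : ℝ} (hK : 0 ≤ K) (hK' : 0 ≤ K') (hε : 0 < ε) :
    ∃ δ : ℝ, 0 < δ ∧ δ ≤ 1 ∧ ∀ σ : ℝ, 0 < σ → σ < δ →
      K * σ + K' * σ ^ (1 / 3 : ℝ) ≤ ε := by
  set L : ℝ := K + K' + 1 with hL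
  have hLpos : 0 < L := by rw [hL]; linarith
  refine ⟨min 1 ((ε / L) ^ 3), lt_min one_pos (pow_pos (div_pos hε hLpos) 3), min_le_left _ _,
    fun σ hσ hσδ => ?_⟩
  have hσ1 : σ ≤ 1 := (hσδ.trans_le (min_le_left _ _)).le
  have hσ3 : σ < (ε / L) ^ 3 := hσδ.trans_le (min_le_right _ _)
  have h13 : σ ≤ σ ^ (1 / 3 : ℝ) := by
    conv_lhs => rw [← Real.rpow_one σ]
    exact Real.rpow_le_rpow_of_exponent_ge hσ hσ1 (by norm_num)
  have hroot : σ ^ (1 / 3 : ℝ) ≤ ε / L := by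
    have h1 : σ ^ (1 / 3 : ℝ) ≤ ((ε / L) ^ 3) ^ (1 / 3 : ℝ) :=
      Real.rpow_le_rpow hσ.le hσ3.le (by norm_num)
    have h2 : ((ε / L) ^ 3) ^ (1 / 3 : ℝ) = ε / L := by
      rw [show (1 / 3 : ℝ) = ((3 : ℕ) : ℝ)⁻¹ by norm_num]
      exact Real.pow_rpow_inv_natCast (div_pos hε hLpos).le (by norm_num)
    rw [h2] at h1
    exact h1
  calc K * σ + K' * σ ^ (1 / 3 : ℝ) ≤ K * σ ^ (1 / 3 : ℝ) + K' * σ ^ (1 / 3 : ℝ) := by gcongr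
    _ = (K + K') * σ ^ (1 / 3 : ℝ) := by ring
    _ ≤ (K + K') * (ε / L) := by gcongr
    _ ≤ ε := by
        rw [show (K + K') * (ε / L) = ε * ((K + K') / L) by ring]
        refine mul_le_of_le_one_right hε.le ?_
        rw [div_le_one hLpos, hL]
        linarith

/-! ## Top values of the pairings of parabolic zooms -/

/-- **Weak continuity at the top transports to the zooms.**  If the pairings `t ↦ ∫ ⟪u(t), η⟫`
with every `C_c^∞` field tend to `∫ ⟪u(t₀), η⟫` as `t ↑ t₀`, then for the parabolic zoom
`v = λ u(t₀ + λ²·, x₀ + λ·)` and a test field `φ` supported in `B`,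
`∫_B ⟪v(s), φ⟫ → ∫_B ⟪v(0), φ⟫` as `s ↑ 0`. -/
theorem tendsto_setIntegral_inner_zoom_nhdsLT
    {u : ℝ → (EuclideanSpace ℝ (Fin 3)) → (EuclideanSpace ℝ (Fin 3))} {z₀ : ℝ × (EuclideanSpace ℝ (Fin 3))}
    (hwc : ∀ η : EuclideanSpace ℝ (Fin 3) → EuclideanSpace ℝ (Fin 3), ContDiff ℝ (⊤ : ℕ∞) η →
      HasCompactSupport η →
      Tendsto (fun t => ∫ x, ⟪u t x, η x⟫) (𝓝[<] z₀.1) (𝓝 (∫ x, ⟪u z₀.1 x, η x⟫)))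
    {φ : EuclideanSpace ℝ (Fin 3) → EuclideanSpace ℝ (Fin 3)} (hφ : ContDiff ℝ (⊤ : ℕ∞) φ)
    (hφc : HasCompactSupport φ) {B : Set (EuclideanSpace ℝ (Fin 3))} (hsupp : tsupport φ ⊆ B)
    {c : ℝ} (hc : 0 < c) :
    Tendsto (fun s => ∫ x in B, ⟪(c • stPull (c ^ 2) c z₀.1 z₀.2 u) s x, φ x⟫) (𝓝[<] (0 : ℝ))
      (𝓝 (∫ x in B, ⟪(c • stPull (c ^ 2) c z₀.1 z₀.2 u) 0 x, φ x⟫)) := by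
  have hpair : ∀ s : ℝ, ∫ x in B, ⟪(c • stPull (c ^ 2) c z₀.1 z₀.2 u) s x, φ x⟫ =
      c * (c ^ 3)⁻¹ * ∫ x, ⟪u (z₀.1 + c ^ 2 * s) x, φ (c⁻¹ • (x - z₀.2))⟫ := by
    intro s
    rw [setIntegral_inner_eq_integral_of_tsupport_subset hsupp]
    exact integral_inner_zoom_eq u φ hc z₀.1 z₀.2 s
  obtain ⟨hφk, hφkc⟩ := contDiff_hasCompactSupport_comp_zoom hφ hφc hc z₀.2
  have hg := hwc _ hφk hφkc
  have htime : Tendsto (fun s : ℝ => z₀.1 + c ^ 2 * s) (𝓝[<] (0 : ℝ)) (𝓝[<] z₀.1) := by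
    refine tendsto_nhdsWithin_iff.2 ⟨?_, ?_⟩
    · have h : Tendsto (fun s : ℝ => z₀.1 + c ^ 2 * s) (𝓝 0) (𝓝 (z₀.1 + c ^ 2 * 0)) :=
        ((continuous_const.add (continuous_const.mul continuous_id)).tendsto 0)
      rw [mul_zero, add_zero] at h
      exact h.mono_left nhdsWithin_le_nhds
    · refine eventually_mem_nhdsWithin.mono fun s hs => ?_
      have hs' : s < 0 := hs
      show z₀.1 + c ^ 2 * s < z₀.1
      nlinarith [pow_pos hc 2]
  have h2 := (hg.comp htime).const_mul (c * (c ^ 3)⁻¹)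
  have e : (fun s => ∫ x in B, ⟪(c • stPull (c ^ 2) c z₀.1 z₀.2 u) s x, φ x⟫) =
      fun s => c * (c ^ 3)⁻¹ * ∫ x, ⟪u (z₀.1 + c ^ 2 * s) x, φ (c⁻¹ • (x - z₀.2))⟫ :=
    funext hpair
  rw [e, hpair 0, mul_zero, add_zero]
  exact h2

/-- The top slice of the parabolic zoom: `v(0, y) = λ u(t₀, x₀ + λ y)`. -/
theorem zoom_apply_zero (u : ℝ → (EuclideanSpace ℝ (Fin 3)) → (EuclideanSpace ℝ (Fin 3)))
    (c t₀ : ℝ) (x₀ : EuclideanSpace ℝ (Fin 3)) :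
    (c • stPull (c ^ 2) c t₀ x₀ u) 0 = fun y => c • u t₀ (x₀ + c • y) := by
  funext y
  rw [smul_stPull_apply, mul_zero, add_zero]

/-- **The top values of the zooms at an `L³` apex tend to zero**: if `u(t₀) ∈ L³(B(x₀, ρ))` is
(globally) a.e.-strongly measurable, `‖φ‖ ≤ K₀`, and `λ_j > 0`, `λ_j → 0`, `λ_j a ≤ ρ`, then
`∫_{B(0,a)} ⟪λ_j u(t₀, x₀ + λ_j y), φ(y)⟫ dy → 0` (Hölder on `B(0,a)` and the scaling-out of the
local `L³` norm, Seregin 2014 §6.6 p. 127). -/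
theorem tendsto_setIntegral_inner_zoom_zero
    {u : ℝ → (EuclideanSpace ℝ (Fin 3)) → (EuclideanSpace ℝ (Fin 3))} {z₀ : ℝ × (EuclideanSpace ℝ (Fin 3))}
    {ρ : ℝ} (hρ : 0 < ρ) (htop : MemLp (u z₀.1) 3 (volume.restrict (ball z₀.2 ρ)))
    (htopm : AEStronglyMeasurable (u z₀.1) volume)
    {φ : EuclideanSpace ℝ (Fin 3) → EuclideanSpace ℝ (Fin 3)} {K₀ : ℝ} (hK₀ : ∀ x, ‖φ x‖ ≤ K₀)
    {a : ℝ} (ha : 0 < a) {c : ℕ → ℝ} (hc : ∀ j, 0 < c j) (hca : ∀ j, c j * a ≤ ρ)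
    (hlim : Tendsto c atTop (𝓝 0)) :
    Tendsto (fun j => ∫ x in ball (0 : EuclideanSpace ℝ (Fin 3)) a,
      ⟪(c j • stPull (c j ^ 2) (c j) z₀.1 z₀.2 u) 0 x, φ x⟫) atTop (𝓝 0) := by
  set B : Set (EuclideanSpace ℝ (Fin 3)) := ball (0 : EuclideanSpace ℝ (Fin 3)) a with hBdef
  have hVBtop : volume B ≠ ⊤ := measure_ball_lt_top.ne
  have hmeas : ∀ j, AEStronglyMeasurable ((c j • stPull (c j ^ 2) (c j) z₀.1 z₀.2 u) 0)
      (volume.restrict B) := fun j => by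
    rw [zoom_apply_zero]
    have hq : Measure.QuasiMeasurePreserving (fun y : EuclideanSpace ℝ (Fin 3) => z₀.2 + c j • y)
        volume volume := by
      refine ⟨(measurable_const_add _).comp (measurable_const_smul _), ?_⟩
      rw [map_space_affine_volume (hc j)]
      exact Measure.smul_absolutelyContinuous
    exact ((htopm.comp_quasiMeasurePreserving hq).const_smul (c j)).mono_measure
      Measure.restrict_le_self
  -- the scaling-out identity `‖λ V(x₀ + λ·)‖_{L³(B(0,a))} = ‖V‖_{L³(B(x₀, λ a))}`
  have hident : ∀ {lc : ℝ}, 0 < lc →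
      eLpNorm (fun y => lc • u z₀.1 (z₀.2 + lc • y)) 3 (volume.restrict B) =
        eLpNorm (u z₀.1) 3 (volume.restrict (ball z₀.2 (lc * a))) := by
    intro l hl
    have hpre := space_affine_preimage_ball_zoom hl z₀.2 0 a
    rw [smul_zero, add_zero] at hpre
    have hlin : ∫⁻ y in B, ‖l • u z₀.1 (z₀.2 + l • y)‖ₑ ^ (3 : ℝ) =
        ENNReal.ofReal (l ^ (3 : ℝ) * (l ^ 3)⁻¹) * ∫⁻ x in ball z₀.2 (l * a), ‖u z₀.1 x‖ₑ ^ (3 : ℝ) := by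
      rw [hBdef, ← hpre]
      have hF : (fun y : EuclideanSpace ℝ (Fin 3) => ‖l • u z₀.1 (z₀.2 + l • y)‖ₑ ^ (3 : ℝ)) =
          fun y => (fun x => ENNReal.ofReal l ^ (3 : ℝ) * ‖u z₀.1 x‖ₑ ^ (3 : ℝ)) (z₀.2 + l • y) := by
        funext y
        simp only [enorm_smul, Real.enorm_eq_ofReal hl.le]
        rw [ENNReal.mul_rpow_of_nonneg _ _ (by norm_num)]
      rw [show (∫⁻ y in (fun x : EuclideanSpace ℝ (Fin 3) => z₀.2 + l • x) ⁻¹' ball z₀.2 (l * a),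
          ‖l • u z₀.1 (z₀.2 + l • y)‖ₑ ^ (3 : ℝ)) =
          ∫⁻ y in (fun x : EuclideanSpace ℝ (Fin 3) => z₀.2 + l • x) ⁻¹' ball z₀.2 (l * a),
            (fun x => ENNReal.ofReal l ^ (3 : ℝ) * ‖u z₀.1 x‖ₑ ^ (3 : ℝ)) (z₀.2 + l • y) from by rw [hF],
        setLIntegral_preimage_comp_space_affine (E := EuclideanSpace ℝ (Fin 3)) hl z₀.2
          (fun x => ENNReal.ofReal l ^ (3 : ℝ) * ‖u z₀.1 x‖ₑ ^ (3 : ℝ)) (ball z₀.2 (l * a)),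
        finrank_euclideanSpace_fin,
        lintegral_const_mul' _ _ (ENNReal.rpow_ne_top_of_nonneg (by norm_num) ENNReal.ofReal_ne_top),
        ← mul_assoc, ENNReal.ofReal_rpow_of_nonneg hl.le (by norm_num),
        ← ENNReal.ofReal_mul (by positivity), mul_comm ((l ^ 3)⁻¹)]
    rw [eLpNorm_eq_lintegral_rpow_enorm_toReal (by norm_num) (by norm_num),
      eLpNorm_eq_lintegral_rpow_enorm_toReal (by norm_num) (by norm_num)]
    have h3 : (3 : ℝ≥0∞).toReal = 3 := by norm_num
    rw [h3, hlin]
    have hl3 : l ^ (3 : ℝ) * (l ^ 3)⁻¹ = 1 := by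
      have e : l ^ (3 : ℝ) = l ^ (3 : ℕ) := by exact_mod_cast Real.rpow_natCast l 3
      rw [e, mul_inv_cancel₀ (pow_ne_zero 3 hl.ne')]
    rw [hl3, ENNReal.ofReal_one, one_mul]
  have hfin : ∀ j, eLpNorm ((c j • stPull (c j ^ 2) (c j) z₀.1 z₀.2 u) 0) 3 (volume.restrict B) ≠ ⊤ :=
    fun j => by
    rw [zoom_apply_zero, hident (hc j)]
    exact ((eLpNorm_mono_measure _ (Measure.restrict_mono (ball_subset_ball (hca j)) le_rfl)).trans_lt
      htop.eLpNorm_lt_top).ne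
  -- `‖V‖_{L³(B(x₀, r))} → 0` as `r ↓ 0` (absolute continuity on shrinking balls)
  have hsmall : Tendsto (fun r : ℝ => eLpNorm (u z₀.1) 3 (volume.restrict (ball z₀.2 r)))
      (𝓝[>] 0) (𝓝 0) := by
    have hfin3 : ∫⁻ x in ball z₀.2 ρ, ‖u z₀.1 x‖ₑ ^ (3 : ℝ≥0∞).toReal ≠ ⊤ :=
      (lintegral_rpow_enorm_lt_top_of_eLpNorm_lt_top (by norm_num) (by norm_num) htop.eLpNorm_lt_top).ne
    have hmeas : Tendsto ((volume.restrict (ball z₀.2 ρ)) ∘ fun r : ℝ => ball z₀.2 r)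
        (𝓝[>] 0) (𝓝 0) := by
      have hup : Tendsto (fun r : ℝ => ENNReal.ofReal (r ^ 3) *
          volume (ball (0 : EuclideanSpace ℝ (Fin 3)) 1)) (𝓝[>] 0) (𝓝 0) := by
        have h0 : Tendsto (fun r : ℝ => ENNReal.ofReal (r ^ 3)) (𝓝[>] (0 : ℝ)) (𝓝 0) := by
          have h := ENNReal.tendsto_ofReal (((continuous_pow 3).tendsto (0 : ℝ)).mono_left
            (nhdsWithin_le_nhds (s := Ioi (0 : ℝ))))
          simpa using h
        have h := ENNReal.Tendsto.mul_const h0 (Or.inr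
          (measure_ball_lt_top (μ := (volume : Measure (EuclideanSpace ℝ (Fin 3))))
            (x := 0) (r := 1)).ne)
        rwa [zero_mul] at h
      refine tendsto_of_tendsto_of_tendsto_of_le_of_le' tendsto_const_nhds hup
        (Eventually.of_forall fun _ => bot_le) ?_
      filter_upwards [eventually_mem_nhdsWithin] with r hr
      calc ((volume.restrict (ball z₀.2 ρ)) ∘ fun r : ℝ => ball z₀.2 r) r
          = (volume.restrict (ball z₀.2 ρ)) (ball z₀.2 r) := rfl
        _ ≤ volume (ball z₀.2 r) := Measure.restrict_apply_le _ _
        _ = ENNReal.ofReal (r ^ 3) * volume (ball (0 : EuclideanSpace ℝ (Fin 3)) 1) := by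
            rw [Measure.addHaar_ball_of_pos volume z₀.2 (mem_Ioi.1 hr), finrank_euclideanSpace_fin]
    have h1 := tendsto_setLIntegral_zero (μ := volume.restrict (ball z₀.2 ρ)) hfin3 hmeas
    have h2 : Tendsto (fun r : ℝ => ∫⁻ x in ball z₀.2 r, ‖u z₀.1 x‖ₑ ^ (3 : ℝ≥0∞).toReal)
        (𝓝[>] 0) (𝓝 0) := by
      refine h1.congr' ?_
      filter_upwards [Ioo_mem_nhdsGT hρ] with r hr
      rw [Measure.restrict_restrict measurableSet_ball,
        inter_eq_left.2 (ball_subset_ball hr.2.le)]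
    have h3 : Tendsto (fun r : ℝ => (∫⁻ x in ball z₀.2 r, ‖u z₀.1 x‖ₑ ^ (3 : ℝ≥0∞).toReal) ^
        (1 / (3 : ℝ≥0∞).toReal)) (𝓝[>] 0) (𝓝 0) := by
      have h := ((ENNReal.continuous_rpow_const (y := 1 / (3 : ℝ≥0∞).toReal)).tendsto 0).comp h2
      rwa [ENNReal.zero_rpow_of_pos (by norm_num)] at h
    refine h3.congr' (Eventually.of_forall fun r => ?_)
    exact (eLpNorm_eq_lintegral_rpow_enorm_toReal (by norm_num) (by norm_num)).symm
  have h3 : Tendsto (fun j => eLpNorm (fun y => c j • u z₀.1 (z₀.2 + c j • y)) 3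
      (volume.restrict B)) atTop (𝓝 0) := by
    have hca' : Tendsto (fun j => c j * a) atTop (𝓝[>] 0) := by
      refine tendsto_nhdsWithin_iff.2 ⟨?_, Eventually.of_forall fun j => mul_pos (hc j) ha⟩
      have h := hlim.mul_const a
      rwa [zero_mul] at h
    refine (hsmall.comp hca').congr fun j => ?_
    exact (hident (hc j)).symm
  have h3' : Tendsto (fun j => eLpNorm ((c j • stPull (c j ^ 2) (c j) z₀.1 z₀.2 u) 0) 3
      (volume.restrict B) * volume B ^ (2 / 3 : ℝ)) atTop (𝓝 0) := by
    have h := ENNReal.Tendsto.mul_const h3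
      (Or.inr (ENNReal.rpow_ne_top_of_nonneg (show (0 : ℝ) ≤ 2 / 3 by norm_num) hVBtop))
    rw [zero_mul] at h
    refine h.congr fun j => ?_
    rw [zoom_apply_zero]
  have h4 : Tendsto (fun j => K₀ * (eLpNorm ((c j • stPull (c j ^ 2) (c j) z₀.1 z₀.2 u) 0) 3
      (volume.restrict B) * volume B ^ (2 / 3 : ℝ)).toReal) atTop (𝓝 0) := by
    have h := ((ENNReal.tendsto_toReal ENNReal.zero_ne_top).comp h3').const_mul K₀
    rwa [ENNReal.toReal_zero, mul_zero] at h
  refine squeeze_zero_norm (fun j => ?_) h4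
  rw [Real.norm_eq_abs]
  exact abs_setIntegral_inner_le_eLpNorm_three (hmeas j) (hfin j) hVBtop hK₀

/-! ## Two more bookkeeping facts -/

/-- The open backward slab is exhausted by the balls `Q(0, 2ᵐ)`. -/
theorem lowerHalf_subset_iUnion_two_pow :
    (Iio (0 : ℝ) ×ˢ (univ : Set (EuclideanSpace ℝ (Fin 3)))) ⊆
      ⋃ m : ℕ, parabolicCylinder ((2 : ℝ) ^ m) (0 : ℝ × (EuclideanSpace ℝ (Fin 3))) := by
  rintro ⟨t, x⟩ ⟨ht, -⟩
  obtain ⟨m, hm⟩ := pow_unbounded_of_one_lt (max (-t) ‖x‖ + 1) (by norm_num : (1 : ℝ) < 2)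
  refine mem_iUnion.2 ⟨m, ?_⟩
  have ht' : t < 0 := ht
  rw [mem_parabolicCylinder]
  simp only [Prod.fst_zero, Prod.snd_zero, zero_sub, dist_zero_right]
  have h2 : -t < (2 : ℝ) ^ m := by linarith [le_max_left (-t) ‖x‖]
  have h3 : ‖x‖ < (2 : ℝ) ^ m := by linarith [le_max_right (-t) ‖x‖]
  have h1 : (1 : ℝ) ≤ (2 : ℝ) ^ m := one_le_pow₀ (by norm_num)
  exact ⟨⟨by nlinarith, ht'⟩, h3⟩

/-- `L¹ ≤ L³ · |Q|^{2/3}` on a set of finite measure (Hölder). -/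
theorem lintegral_enorm_le_eLpNorm_three_mul {S : Set (ℝ × EuclideanSpace ℝ (Fin 3))}
    {f : ℝ × EuclideanSpace ℝ (Fin 3) → EuclideanSpace ℝ (Fin 3)}
    (hf : AEStronglyMeasurable f (volume.restrict S)) :
    ∫⁻ q in S, ‖f q‖ₑ ≤ eLpNorm f 3 (volume.restrict S) * volume S ^ (2 / 3 : ℝ) := by
  have h := eLpNorm_le_eLpNorm_mul_rpow_measure_univ (μ := volume.restrict S)
    (p := 1) (q := (3 : ℝ≥0∞)) (by norm_num) hf
  rw [Measure.restrict_apply_univ, eLpNorm_one_eq_lintegral_enorm] at h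
  have hexp : (1 / (1 : ℝ≥0∞).toReal - 1 / (3 : ℝ≥0∞).toReal : ℝ) = 2 / 3 := by
    rw [ENNReal.toReal_one, ENNReal.toReal_ofNat]; norm_num
  rwa [hexp] at h

/-! ## The zoomed top slice -/

/-- **The zoomed terminal value is locally `L³`**: if `u(T) ∈ L³(B(x₀, ρ₃))` and `R ρ ≤ ρ₃` then
`α u(T, x₀ + R·) ∈ L³(B(0, ρ))` (change of variables `y ↦ x₀ + Ry`). -/
theorem memLp_three_top_slice {f : EuclideanSpace ℝ (Fin 3) → EuclideanSpace ℝ (Fin 3)}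
    {x₀ : EuclideanSpace ℝ (Fin 3)} {ρ₃ R ρ : ℝ} (α : ℝ) (hR : 0 < R) (hRρ : R * ρ ≤ ρ₃)
    (hf : MemLp f 3 (volume.restrict (ball x₀ ρ₃))) :
    MemLp (fun y => α • f (x₀ + R • y)) 3 (volume.restrict (ball (0 : EuclideanSpace ℝ (Fin 3)) ρ)) := by
  have hme := (spaceAffineHomeomorph hR.ne' x₀).measurableEmbedding
  have hpre : (fun y : EuclideanSpace ℝ (Fin 3) => x₀ + R • y) ⁻¹' ball x₀ (R * ρ) =
      ball (0 : EuclideanSpace ℝ (Fin 3)) ρ := by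
    rw [space_affine_preimage_ball hR, sub_self, smul_zero, mul_div_cancel_left₀ _ hR.ne']
  have hmap : Measure.map (spaceAffineHomeomorph hR.ne' x₀)
      (volume.restrict (ball (0 : EuclideanSpace ℝ (Fin 3)) ρ)) =
      ENNReal.ofReal (R ^ 3)⁻¹ • volume.restrict (ball x₀ (R * ρ)) := by
    rw [← hpre, ← coe_spaceAffineHomeomorph hR.ne' x₀, ← hme.restrict_map, coe_spaceAffineHomeomorph,
      map_space_affine_volume hR, finrank_euclideanSpace_fin, Measure.restrict_smul]
  have h1 : MemLp f 3 (Measure.map (spaceAffineHomeomorph hR.ne' x₀)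
      (volume.restrict (ball (0 : EuclideanSpace ℝ (Fin 3)) ρ))) := by
    rw [hmap]
    exact (hf.mono_measure (Measure.restrict_mono (ball_subset_ball hRρ) le_rfl)).smul_measure
      ENNReal.ofReal_ne_top
  have h2 : MemLp (f ∘ spaceAffineHomeomorph hR.ne' x₀) 3
      (volume.restrict (ball (0 : EuclideanSpace ℝ (Fin 3)) ρ)) :=
    (hme.memLp_map_measure_iff).1 h1
  rw [coe_spaceAffineHomeomorph] at h2
  exact h2.const_smul α

/-- The zoomed terminal value is a.e.-strongly measurable on the whole space. -/
theorem aestronglyMeasurable_top_slice {f : EuclideanSpace ℝ (Fin 3) → EuclideanSpace ℝ (Fin 3)}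
    (hf : AEStronglyMeasurable f volume) (α : ℝ) {R : ℝ} (hR : 0 < R) (x₀ : EuclideanSpace ℝ (Fin 3)) :
    AEStronglyMeasurable (fun y => α • f (x₀ + R • y)) volume := by
  have hq : Measure.QuasiMeasurePreserving (fun y : EuclideanSpace ℝ (Fin 3) => x₀ + R • y)
      volume volume := by
    refine ⟨(measurable_const_add _).comp (measurable_const_smul _), ?_⟩
    rw [map_space_affine_volume hR]
    exact Measure.smul_absolutelyContinuous
  exact (hf.comp_quasiMeasurePreserving hq).const_smul α

end Summit.NavierStokesRegularity.NavierStokesRegularity.Theorems.TerminalTraceExtinctApexZoom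

end
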